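import Summits.CriticalPhenomena.PercolationContinuityZ3.Theorems.PercNearOneGluingNoHeavyLowerTailSahiOneStepFreeBlockReducePrelim
import HarnessLib

/-!
# Two-sided lumping with a free block — part 1: the partner reductions do not increase `Ψ`

Support file (prover prim-ineq-prove-3 gen 53; `--supports stmt-CriticalPhenomena-4575`; memo
`run/shared/lean/prim/prim-ineq-prove-3/PROOF-G53-TL-FREE-BLOCK.md` §1, §3).  No definitions, no named facts, no sorries, no `native_decide`.

Setting: `μ = prodBernoulli p` (ANY density vector), blocks `K ⊆ S`, `R = S ∖ K`, levels `t, s`, `T = Th_t(S)`, `V = Th_s(S)`, and gen 50's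
TWO-SIDED LUMPING FUNCTIONAL (written out, as in `…TwoLumpStep`)
`Ψ(A,B) = (1−μT)μV(μ(T∩A∩B) − μ(V∩A∩B)) + μV(μA − μ(T∩A))(μB − μ(T∩B)) + (1−μT)μ(V∩A)μ(V∩B) − (1−μT)μV·μA·μB`.
* §1 `twoLump_union_right`: `Ψ(A, X ⊔ D) = Ψ(A,X) + VAR(A,D)`, `VAR` linear in `D`;
* §2 on a single `K`-level `k` (`D ⊆ {#(K∩ω) = k}`, `K`-determined): `μ(T∩D) = μD·τ_k`, `μ(V∩D) = μD·σ_k` with `τ_k = μ{t ≤ #(R∩ω)+k}`,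
  `σ_k = μ{s ≤ #(R∩ω)+k}` (independence), hence `VAR(A,D) = μD·Cout(k)` for `D` disjoint from `A` and `= μD·Cin(k)` for `D ⊆ A`, where
  `Cout(k) = μV(μA−μ(T∩A))(1−τ_k) + (1−μT)μ(V∩A)σ_k − (1−μT)μV·μA` and `Cin(k) = Cout(k) + (1−μT)μV(τ_k − σ_k)`;
* §3 multi-level sign lemmas (induction over the levels);
* (part 2, `…TwoLumpReduce`) the COSTLY REGION `G = (A ∩ {g₁ ≤ #(K∩ω)}) ∪ {g₂ ≤ #(K∩ω)}` (`g₁ ≤ g₂`), the hull `B♯` of `B` over `G` and the removal `B₂ = ↑(B♯ ∖ G)`, and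
  **`twoLump_sharp_le`**, **`twoLump_lift_le`**: `Ψ(A,B₂) ≤ Ψ(A,B♯) ≤ Ψ(A,B)` under the level-sign hypotheses (`Cout ≤ 0` below `g₂`, `≥ 0` from `g₂`;
  `Cin ≤ 0` below `g₁`, `≥ 0` from `g₁`), which `…TwoLumpLevels` (LEMMA U) provides.
-/

noncomputable section

namespace Summit.CriticalPhenomena.PercolationContinuityZ3.Theorems

namespace SahiOneStep

open MeasureTheory Finset
open Literature.Probability.Percolation (DeterminedBy determinedBy_iff)
open Literature.Probability.LatticeModels (prodBernoulli prodBernoulli_real_inter_of_determinedBy_disjoint)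
open Literature.Probability.Percolation.DecisionTree (ind)
open scoped Classical

variable {ι : Type*} [Fintype ι]

/-! ## §1 The variation of `Ψ` in the partner -/

/-- `VAR` is additive over disjoint unions (it is linear in the indicator of `D`). [this work] -/
theorem twoLumpVar_union (p : ι → unitInterval) (T V A X D : Set (Set ι)) (hXD : Disjoint X D) :
    (1 - (prodBernoulli p).real T) * (prodBernoulli p).real V *
          ((prodBernoulli p).real (T ∩ A ∩ (X ∪ D)) - (prodBernoulli p).real (V ∩ A ∩ (X ∪ D)))
        + (prodBernoulli p).real V * ((prodBernoulli p).real A - (prodBernoulli p).real (T ∩ A)) *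
          ((prodBernoulli p).real (X ∪ D) - (prodBernoulli p).real (T ∩ (X ∪ D)))
        + (1 - (prodBernoulli p).real T) * (prodBernoulli p).real (V ∩ A) * (prodBernoulli p).real (V ∩ (X ∪ D))
        - (1 - (prodBernoulli p).real T) * (prodBernoulli p).real V * (prodBernoulli p).real A * (prodBernoulli p).real (X ∪ D) =
      ((1 - (prodBernoulli p).real T) * (prodBernoulli p).real V *
          ((prodBernoulli p).real (T ∩ A ∩ X) - (prodBernoulli p).real (V ∩ A ∩ X))
        + (prodBernoulli p).real V * ((prodBernoulli p).real A - (prodBernoulli p).real (T ∩ A)) *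
          ((prodBernoulli p).real X - (prodBernoulli p).real (T ∩ X))
        + (1 - (prodBernoulli p).real T) * (prodBernoulli p).real (V ∩ A) * (prodBernoulli p).real (V ∩ X)
        - (1 - (prodBernoulli p).real T) * (prodBernoulli p).real V * (prodBernoulli p).real A * (prodBernoulli p).real X)
      + ((1 - (prodBernoulli p).real T) * (prodBernoulli p).real V *
          ((prodBernoulli p).real (T ∩ A ∩ D) - (prodBernoulli p).real (V ∩ A ∩ D))
        + (prodBernoulli p).real V * ((prodBernoulli p).real A - (prodBernoulli p).real (T ∩ A)) *
          ((prodBernoulli p).real D - (prodBernoulli p).real (T ∩ D))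
        + (1 - (prodBernoulli p).real T) * (prodBernoulli p).real (V ∩ A) * (prodBernoulli p).real (V ∩ D)
        - (1 - (prodBernoulli p).real T) * (prodBernoulli p).real V * (prodBernoulli p).real A * (prodBernoulli p).real D) := by
  rw [Set.inter_union_distrib_left (T ∩ A), Set.inter_union_distrib_left (V ∩ A), Set.inter_union_distrib_left T,
    Set.inter_union_distrib_left V,
    measureReal_union (hXD.mono Set.inter_subset_right Set.inter_subset_right) MeasurableSet.of_discrete,
    measureReal_union (hXD.mono Set.inter_subset_right Set.inter_subset_right) MeasurableSet.of_discrete,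
    measureReal_union (hXD.mono Set.inter_subset_right Set.inter_subset_right) MeasurableSet.of_discrete,
    measureReal_union (hXD.mono Set.inter_subset_right Set.inter_subset_right) MeasurableSet.of_discrete,
    measureReal_union hXD MeasurableSet.of_discrete]
  ring

/-- **Variation of `Ψ` in the partner**: `Ψ(A, X ⊔ D) = Ψ(A, X) + VAR(A, D)`. [this work] -/
theorem twoLump_union_right (p : ι → unitInterval) (T V A X D : Set (Set ι)) (hXD : Disjoint X D) :
    (1 - (prodBernoulli p).real T) * (prodBernoulli p).real V *
          ((prodBernoulli p).real (T ∩ A ∩ (X ∪ D)) - (prodBernoulli p).real (V ∩ A ∩ (X ∪ D)))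
        + (prodBernoulli p).real V * ((prodBernoulli p).real A - (prodBernoulli p).real (T ∩ A)) *
          ((prodBernoulli p).real (X ∪ D) - (prodBernoulli p).real (T ∩ (X ∪ D)))
        + (1 - (prodBernoulli p).real T) * (prodBernoulli p).real (V ∩ A) * (prodBernoulli p).real (V ∩ (X ∪ D))
        - (1 - (prodBernoulli p).real T) * (prodBernoulli p).real V * (prodBernoulli p).real A * (prodBernoulli p).real (X ∪ D) =
      ((1 - (prodBernoulli p).real T) * (prodBernoulli p).real V *
          ((prodBernoulli p).real (T ∩ A ∩ X) - (prodBernoulli p).real (V ∩ A ∩ X))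
        + (prodBernoulli p).real V * ((prodBernoulli p).real A - (prodBernoulli p).real (T ∩ A)) *
          ((prodBernoulli p).real X - (prodBernoulli p).real (T ∩ X))
        + (1 - (prodBernoulli p).real T) * (prodBernoulli p).real (V ∩ A) * (prodBernoulli p).real (V ∩ X)
        - (1 - (prodBernoulli p).real T) * (prodBernoulli p).real V * (prodBernoulli p).real A * (prodBernoulli p).real X)
      + ((1 - (prodBernoulli p).real T) * (prodBernoulli p).real V *
          ((prodBernoulli p).real (T ∩ A ∩ D) - (prodBernoulli p).real (V ∩ A ∩ D))
        + (prodBernoulli p).real V * ((prodBernoulli p).real A - (prodBernoulli p).real (T ∩ A)) *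
          ((prodBernoulli p).real D - (prodBernoulli p).real (T ∩ D))
        + (1 - (prodBernoulli p).real T) * (prodBernoulli p).real (V ∩ A) * (prodBernoulli p).real (V ∩ D)
        - (1 - (prodBernoulli p).real T) * (prodBernoulli p).real V * (prodBernoulli p).real A * (prodBernoulli p).real D) :=
  twoLumpVar_union p T V A X D hXD

/-! ## §2 A single level of the block `K` inside the slot block `S` -/

/-- On a single `K`-level `k`, the `T = Th_t(S)`-part of a `K`-determined `D` factors: `μ(T ∩ D) = μD · μ{t ≤ #((S∖K)∩ω) + k}`. [this work] -/
theorem real_threshold_inter_level (p : ι → unitInterval) {K S : Finset ι} (hKS : K ⊆ S) (t k : ℕ) {D : Set (Set ι)}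
    (hDK : DeterminedBy D (↑K : Set ι)) (hlev : ∀ ω ∈ D, (K.filter (· ∈ ω)).card = k) :
    (prodBernoulli p).real ({ω : Set ι | t ≤ (S.filter (· ∈ ω)).card} ∩ D) =
      (prodBernoulli p).real D * (prodBernoulli p).real {ω : Set ι | t ≤ ((S \ K).filter (· ∈ ω)).card + k} := by
  have hset : {ω : Set ι | t ≤ (S.filter (· ∈ ω)).card} ∩ D = D ∩ {ω : Set ι | t ≤ ((S \ K).filter (· ∈ ω)).card + k} := by
    ext ω
    simp only [Set.mem_inter_iff, Set.mem_setOf_eq]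
    constructor
    · rintro ⟨h1, h2⟩
      have := card_filter_eq_add_sdiff hKS ω; have := hlev ω h2
      exact ⟨h2, by omega⟩
    · rintro ⟨h2, h1⟩
      have := card_filter_eq_add_sdiff hKS ω; have := hlev ω h2
      exact ⟨by omega, h2⟩
  rw [hset]
  exact prodBernoulli_real_inter_of_determinedBy_disjoint p Finset.disjoint_sdiff hDK (determinedBy_shiftedThreshold (S \ K) t k)
    MeasurableSet.of_discrete MeasurableSet.of_discrete
where
  /-- `{t ≤ #(R∩ω) + k}` is `R`-determined -/
  determinedBy_shiftedThreshold (R : Finset ι) (t k : ℕ) :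
      DeterminedBy {ω : Set ι | t ≤ (R.filter (· ∈ ω)).card + k} (↑R : Set ι) := by
    rw [determinedBy_iff]
    intro ω ω' h
    have hf : R.filter (· ∈ ω) = R.filter (· ∈ ω') := by
      ext i
      simp only [Finset.mem_filter, and_congr_right_iff]
      intro hi
      have := Set.ext_iff.1 h i
      simp only [Set.mem_inter_iff, Finset.mem_coe] at this
      exact ⟨fun h1 => (this.1 ⟨h1, hi⟩).1, fun h1 => (this.2 ⟨h1, hi⟩).1⟩
    simp only [Set.mem_setOf_eq, hf]

/-- **`VAR` on a single level, `D` disjoint from `A`**: `VAR(A,D) = μD · Cout(k)`. [this work] -/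
theorem twoLumpVar_level_out (p : ι → unitInterval) {K S : Finset ι} (hKS : K ⊆ S) (t s k : ℕ) {A D : Set (Set ι)}
    (hDK : DeterminedBy D (↑K : Set ι)) (hlev : ∀ ω ∈ D, (K.filter (· ∈ ω)).card = k) (hDA : Disjoint D A) :
    (1 - (prodBernoulli p).real {ω : Set ι | t ≤ (S.filter (· ∈ ω)).card}) * (prodBernoulli p).real {ω : Set ι | s ≤ (S.filter (· ∈ ω)).card} *
          ((prodBernoulli p).real ({ω : Set ι | t ≤ (S.filter (· ∈ ω)).card} ∩ A ∩ D)
            - (prodBernoulli p).real ({ω : Set ι | s ≤ (S.filter (· ∈ ω)).card} ∩ A ∩ D))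
        + (prodBernoulli p).real {ω : Set ι | s ≤ (S.filter (· ∈ ω)).card} *
          ((prodBernoulli p).real A - (prodBernoulli p).real ({ω : Set ι | t ≤ (S.filter (· ∈ ω)).card} ∩ A)) *
          ((prodBernoulli p).real D - (prodBernoulli p).real ({ω : Set ι | t ≤ (S.filter (· ∈ ω)).card} ∩ D))
        + (1 - (prodBernoulli p).real {ω : Set ι | t ≤ (S.filter (· ∈ ω)).card}) *
          (prodBernoulli p).real ({ω : Set ι | s ≤ (S.filter (· ∈ ω)).card} ∩ A) *
          (prodBernoulli p).real ({ω : Set ι | s ≤ (S.filter (· ∈ ω)).card} ∩ D)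
        - (1 - (prodBernoulli p).real {ω : Set ι | t ≤ (S.filter (· ∈ ω)).card}) * (prodBernoulli p).real {ω : Set ι | s ≤ (S.filter (· ∈ ω)).card} *
          (prodBernoulli p).real A * (prodBernoulli p).real D =
      (prodBernoulli p).real D *
        ((prodBernoulli p).real {ω : Set ι | s ≤ (S.filter (· ∈ ω)).card} *
            ((prodBernoulli p).real A - (prodBernoulli p).real ({ω : Set ι | t ≤ (S.filter (· ∈ ω)).card} ∩ A)) *
            (1 - (prodBernoulli p).real {ω : Set ι | t ≤ ((S \ K).filter (· ∈ ω)).card + k})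
          + (1 - (prodBernoulli p).real {ω : Set ι | t ≤ (S.filter (· ∈ ω)).card}) *
            (prodBernoulli p).real ({ω : Set ι | s ≤ (S.filter (· ∈ ω)).card} ∩ A) *
            (prodBernoulli p).real {ω : Set ι | s ≤ ((S \ K).filter (· ∈ ω)).card + k}
          - (1 - (prodBernoulli p).real {ω : Set ι | t ≤ (S.filter (· ∈ ω)).card}) * (prodBernoulli p).real {ω : Set ι | s ≤ (S.filter (· ∈ ω)).card} *
            (prodBernoulli p).real A) := by
  have hTAD : {ω : Set ι | t ≤ (S.filter (· ∈ ω)).card} ∩ A ∩ D = ∅ :=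
    Set.eq_empty_of_forall_notMem fun ω h => Set.disjoint_left.1 hDA h.2 h.1.2
  have hVAD : {ω : Set ι | s ≤ (S.filter (· ∈ ω)).card} ∩ A ∩ D = ∅ :=
    Set.eq_empty_of_forall_notMem fun ω h => Set.disjoint_left.1 hDA h.2 h.1.2
  rw [hTAD, hVAD, measureReal_empty, real_threshold_inter_level p hKS t k hDK hlev, real_threshold_inter_level p hKS s k hDK hlev]
  ring

/-- **`VAR` on a single level, `D ⊆ A`**: `VAR(A,D) = μD · Cin(k)`, `Cin(k) = Cout(k) + (1−μT)μV(τ_k − σ_k)`. [this work] -/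
theorem twoLumpVar_level_in (p : ι → unitInterval) {K S : Finset ι} (hKS : K ⊆ S) (t s k : ℕ) {A D : Set (Set ι)}
    (hDK : DeterminedBy D (↑K : Set ι)) (hlev : ∀ ω ∈ D, (K.filter (· ∈ ω)).card = k) (hDA : D ⊆ A) :
    (1 - (prodBernoulli p).real {ω : Set ι | t ≤ (S.filter (· ∈ ω)).card}) * (prodBernoulli p).real {ω : Set ι | s ≤ (S.filter (· ∈ ω)).card} *
          ((prodBernoulli p).real ({ω : Set ι | t ≤ (S.filter (· ∈ ω)).card} ∩ A ∩ D)
            - (prodBernoulli p).real ({ω : Set ι | s ≤ (S.filter (· ∈ ω)).card} ∩ A ∩ D))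
        + (prodBernoulli p).real {ω : Set ι | s ≤ (S.filter (· ∈ ω)).card} *
          ((prodBernoulli p).real A - (prodBernoulli p).real ({ω : Set ι | t ≤ (S.filter (· ∈ ω)).card} ∩ A)) *
          ((prodBernoulli p).real D - (prodBernoulli p).real ({ω : Set ι | t ≤ (S.filter (· ∈ ω)).card} ∩ D))
        + (1 - (prodBernoulli p).real {ω : Set ι | t ≤ (S.filter (· ∈ ω)).card}) *
          (prodBernoulli p).real ({ω : Set ι | s ≤ (S.filter (· ∈ ω)).card} ∩ A) *
          (prodBernoulli p).real ({ω : Set ι | s ≤ (S.filter (· ∈ ω)).card} ∩ D)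
        - (1 - (prodBernoulli p).real {ω : Set ι | t ≤ (S.filter (· ∈ ω)).card}) * (prodBernoulli p).real {ω : Set ι | s ≤ (S.filter (· ∈ ω)).card} *
          (prodBernoulli p).real A * (prodBernoulli p).real D =
      (prodBernoulli p).real D *
        ((1 - (prodBernoulli p).real {ω : Set ι | t ≤ (S.filter (· ∈ ω)).card}) * (prodBernoulli p).real {ω : Set ι | s ≤ (S.filter (· ∈ ω)).card} *
            ((prodBernoulli p).real {ω : Set ι | t ≤ ((S \ K).filter (· ∈ ω)).card + k}
              - (prodBernoulli p).real {ω : Set ι | s ≤ ((S \ K).filter (· ∈ ω)).card + k})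
          + ((prodBernoulli p).real {ω : Set ι | s ≤ (S.filter (· ∈ ω)).card} *
              ((prodBernoulli p).real A - (prodBernoulli p).real ({ω : Set ι | t ≤ (S.filter (· ∈ ω)).card} ∩ A)) *
              (1 - (prodBernoulli p).real {ω : Set ι | t ≤ ((S \ K).filter (· ∈ ω)).card + k})
            + (1 - (prodBernoulli p).real {ω : Set ι | t ≤ (S.filter (· ∈ ω)).card}) *
              (prodBernoulli p).real ({ω : Set ι | s ≤ (S.filter (· ∈ ω)).card} ∩ A) *
              (prodBernoulli p).real {ω : Set ι | s ≤ ((S \ K).filter (· ∈ ω)).card + k}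
            - (1 - (prodBernoulli p).real {ω : Set ι | t ≤ (S.filter (· ∈ ω)).card}) *
              (prodBernoulli p).real {ω : Set ι | s ≤ (S.filter (· ∈ ω)).card} * (prodBernoulli p).real A)) := by
  have hTAD : {ω : Set ι | t ≤ (S.filter (· ∈ ω)).card} ∩ A ∩ D = {ω : Set ι | t ≤ (S.filter (· ∈ ω)).card} ∩ D := by
    rw [Set.inter_assoc, Set.inter_eq_self_of_subset_right hDA]
  have hVAD : {ω : Set ι | s ≤ (S.filter (· ∈ ω)).card} ∩ A ∩ D = {ω : Set ι | s ≤ (S.filter (· ∈ ω)).card} ∩ D := by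
    rw [Set.inter_assoc, Set.inter_eq_self_of_subset_right hDA]
  rw [hTAD, hVAD, real_threshold_inter_level p hKS t k hDK hlev, real_threshold_inter_level p hKS s k hDK hlev]
  ring

/-! ## §3 Several levels: `VAR` as a sum over the levels of `K` -/

omit [Fintype ι] in
/-- `VAR(A, ∅) = 0`. [this work] -/
theorem twoLumpVar_empty (p : ι → unitInterval) (S : Finset ι) (t s : ℕ) (A : Set (Set ι)) :
    ((1 - (prodBernoulli p).real {ω : Set ι | t ≤ (S.filter (· ∈ ω)).card}) * (prodBernoulli p).real {ω : Set ι | s ≤ (S.filter (· ∈ ω)).card} *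
          ((prodBernoulli p).real ({ω : Set ι | t ≤ (S.filter (· ∈ ω)).card} ∩ A ∩ (∅ : Set (Set ι)))
            - (prodBernoulli p).real ({ω : Set ι | s ≤ (S.filter (· ∈ ω)).card} ∩ A ∩ (∅ : Set (Set ι))))
        + (prodBernoulli p).real {ω : Set ι | s ≤ (S.filter (· ∈ ω)).card} *
          ((prodBernoulli p).real A - (prodBernoulli p).real ({ω : Set ι | t ≤ (S.filter (· ∈ ω)).card} ∩ A)) *
          ((prodBernoulli p).real (∅ : Set (Set ι)) - (prodBernoulli p).real ({ω : Set ι | t ≤ (S.filter (· ∈ ω)).card} ∩ (∅ : Set (Set ι))))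
        + (1 - (prodBernoulli p).real {ω : Set ι | t ≤ (S.filter (· ∈ ω)).card}) *
          (prodBernoulli p).real ({ω : Set ι | s ≤ (S.filter (· ∈ ω)).card} ∩ A) *
          (prodBernoulli p).real ({ω : Set ι | s ≤ (S.filter (· ∈ ω)).card} ∩ (∅ : Set (Set ι)))
        - (1 - (prodBernoulli p).real {ω : Set ι | t ≤ (S.filter (· ∈ ω)).card}) * (prodBernoulli p).real {ω : Set ι | s ≤ (S.filter (· ∈ ω)).card} *
          (prodBernoulli p).real A * (prodBernoulli p).real (∅ : Set (Set ι))) = 0 := by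
  simp only [Set.inter_empty, measureReal_empty]; ring

/-- **`VAR` as a level sum, `D` disjoint from `A`**: `VAR(A, D ∩ {#K < j}) = Σ_{k<j} μ(D ∩ {#K = k})·Cout(k)`. [this work] -/
theorem twoLumpVar_ballPart_eq_sum_out (p : ι → unitInterval) {K S : Finset ι} (hKS : K ⊆ S) (t s : ℕ) {A D : Set (Set ι)}
    (hDK : DeterminedBy D (↑K : Set ι)) (hDA : Disjoint D A) :
    ∀ j : ℕ, ((1 - (prodBernoulli p).real {ω : Set ι | t ≤ (S.filter (· ∈ ω)).card}) * (prodBernoulli p).real {ω : Set ι | s ≤ (S.filter (· ∈ ω)).card} *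
          ((prodBernoulli p).real ({ω : Set ι | t ≤ (S.filter (· ∈ ω)).card} ∩ A ∩ (D ∩ {ω : Set ι | (K.filter (· ∈ ω)).card < j}))
            - (prodBernoulli p).real ({ω : Set ι | s ≤ (S.filter (· ∈ ω)).card} ∩ A ∩ (D ∩ {ω : Set ι | (K.filter (· ∈ ω)).card < j})))
        + (prodBernoulli p).real {ω : Set ι | s ≤ (S.filter (· ∈ ω)).card} *
          ((prodBernoulli p).real A - (prodBernoulli p).real ({ω : Set ι | t ≤ (S.filter (· ∈ ω)).card} ∩ A)) *
          ((prodBernoulli p).real (D ∩ {ω : Set ι | (K.filter (· ∈ ω)).card < j}) - (prodBernoulli p).real ({ω : Set ι | t ≤ (S.filter (· ∈ ω)).card} ∩ (D ∩ {ω : Set ι | (K.filter (· ∈ ω)).card < j})))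
        + (1 - (prodBernoulli p).real {ω : Set ι | t ≤ (S.filter (· ∈ ω)).card}) *
          (prodBernoulli p).real ({ω : Set ι | s ≤ (S.filter (· ∈ ω)).card} ∩ A) *
          (prodBernoulli p).real ({ω : Set ι | s ≤ (S.filter (· ∈ ω)).card} ∩ (D ∩ {ω : Set ι | (K.filter (· ∈ ω)).card < j}))
        - (1 - (prodBernoulli p).real {ω : Set ι | t ≤ (S.filter (· ∈ ω)).card}) * (prodBernoulli p).real {ω : Set ι | s ≤ (S.filter (· ∈ ω)).card} *
          (prodBernoulli p).real A * (prodBernoulli p).real (D ∩ {ω : Set ι | (K.filter (· ∈ ω)).card < j})) =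
      ∑ k ∈ range j, (prodBernoulli p).real (D ∩ {ω : Set ι | (K.filter (· ∈ ω)).card = k}) *
        ((prodBernoulli p).real {ω : Set ι | s ≤ (S.filter (· ∈ ω)).card} *
            ((prodBernoulli p).real A - (prodBernoulli p).real ({ω : Set ι | t ≤ (S.filter (· ∈ ω)).card} ∩ A)) *
            (1 - (prodBernoulli p).real {ω : Set ι | t ≤ ((S \ K).filter (· ∈ ω)).card + k})
          + (1 - (prodBernoulli p).real {ω : Set ι | t ≤ (S.filter (· ∈ ω)).card}) *
            (prodBernoulli p).real ({ω : Set ι | s ≤ (S.filter (· ∈ ω)).card} ∩ A) *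
            (prodBernoulli p).real {ω : Set ι | s ≤ ((S \ K).filter (· ∈ ω)).card + k}
          - (1 - (prodBernoulli p).real {ω : Set ι | t ≤ (S.filter (· ∈ ω)).card}) * (prodBernoulli p).real {ω : Set ι | s ≤ (S.filter (· ∈ ω)).card} *
            (prodBernoulli p).real A) := by
  intro j
  induction j with
  | zero =>
    have h0 : D ∩ {ω : Set ι | (K.filter (· ∈ ω)).card < 0} = ∅ := Set.eq_empty_of_forall_notMem fun ω h => by
      simp only [Set.mem_inter_iff, Set.mem_setOf_eq] at h; omega
    rw [h0, sum_range_zero]; exact twoLumpVar_empty p S t s A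
  | succ j ih =>
    have hsplit : D ∩ {ω : Set ι | (K.filter (· ∈ ω)).card < j + 1} =
        (D ∩ {ω : Set ι | (K.filter (· ∈ ω)).card < j}) ∪ (D ∩ {ω : Set ι | (K.filter (· ∈ ω)).card = j}) := by
      ext ω; simp only [Set.mem_inter_iff, Set.mem_setOf_eq, Set.mem_union]
      constructor
      · rintro ⟨hD, h⟩
        rcases Nat.lt_succ_iff_lt_or_eq.1 h with h | h
        · exact Or.inl ⟨hD, h⟩
        · exact Or.inr ⟨hD, h⟩
      · rintro (⟨hD, h⟩ | ⟨hD, h⟩)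
        · exact ⟨hD, by omega⟩
        · exact ⟨hD, by omega⟩
    have hdisj : Disjoint (D ∩ {ω : Set ι | (K.filter (· ∈ ω)).card < j}) (D ∩ {ω : Set ι | (K.filter (· ∈ ω)).card = j}) :=
      Set.disjoint_left.2 fun ω h1 h2 => by
        simp only [Set.mem_inter_iff, Set.mem_setOf_eq] at h1 h2; omega
    rw [hsplit, twoLumpVar_union p _ _ A _ _ hdisj, ih, sum_range_succ,
      twoLumpVar_level_out p hKS t s j (hDK.inter (determinedBy_layer K j)) (fun ω h => h.2) (hDA.mono_left Set.inter_subset_left)]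

/-- **`VAR` as a level sum, `D ⊆ A`**: `VAR(A, D ∩ {#K < j}) = Σ_{k<j} μ(D ∩ {#K = k})·Cin(k)`. [this work] -/
theorem twoLumpVar_ballPart_eq_sum_in (p : ι → unitInterval) {K S : Finset ι} (hKS : K ⊆ S) (t s : ℕ) {A D : Set (Set ι)}
    (hDK : DeterminedBy D (↑K : Set ι)) (hDA : D ⊆ A) :
    ∀ j : ℕ, ((1 - (prodBernoulli p).real {ω : Set ι | t ≤ (S.filter (· ∈ ω)).card}) * (prodBernoulli p).real {ω : Set ι | s ≤ (S.filter (· ∈ ω)).card} *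
          ((prodBernoulli p).real ({ω : Set ι | t ≤ (S.filter (· ∈ ω)).card} ∩ A ∩ (D ∩ {ω : Set ι | (K.filter (· ∈ ω)).card < j}))
            - (prodBernoulli p).real ({ω : Set ι | s ≤ (S.filter (· ∈ ω)).card} ∩ A ∩ (D ∩ {ω : Set ι | (K.filter (· ∈ ω)).card < j})))
        + (prodBernoulli p).real {ω : Set ι | s ≤ (S.filter (· ∈ ω)).card} *
          ((prodBernoulli p).real A - (prodBernoulli p).real ({ω : Set ι | t ≤ (S.filter (· ∈ ω)).card} ∩ A)) *
          ((prodBernoulli p).real (D ∩ {ω : Set ι | (K.filter (· ∈ ω)).card < j}) - (prodBernoulli p).real ({ω : Set ι | t ≤ (S.filter (· ∈ ω)).card} ∩ (D ∩ {ω : Set ι | (K.filter (· ∈ ω)).card < j})))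
        + (1 - (prodBernoulli p).real {ω : Set ι | t ≤ (S.filter (· ∈ ω)).card}) *
          (prodBernoulli p).real ({ω : Set ι | s ≤ (S.filter (· ∈ ω)).card} ∩ A) *
          (prodBernoulli p).real ({ω : Set ι | s ≤ (S.filter (· ∈ ω)).card} ∩ (D ∩ {ω : Set ι | (K.filter (· ∈ ω)).card < j}))
        - (1 - (prodBernoulli p).real {ω : Set ι | t ≤ (S.filter (· ∈ ω)).card}) * (prodBernoulli p).real {ω : Set ι | s ≤ (S.filter (· ∈ ω)).card} *
          (prodBernoulli p).real A * (prodBernoulli p).real (D ∩ {ω : Set ι | (K.filter (· ∈ ω)).card < j})) =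
      ∑ k ∈ range j, (prodBernoulli p).real (D ∩ {ω : Set ι | (K.filter (· ∈ ω)).card = k}) *
        ((1 - (prodBernoulli p).real {ω : Set ι | t ≤ (S.filter (· ∈ ω)).card}) * (prodBernoulli p).real {ω : Set ι | s ≤ (S.filter (· ∈ ω)).card} *
            ((prodBernoulli p).real {ω : Set ι | t ≤ ((S \ K).filter (· ∈ ω)).card + k}
              - (prodBernoulli p).real {ω : Set ι | s ≤ ((S \ K).filter (· ∈ ω)).card + k})
          + ((prodBernoulli p).real {ω : Set ι | s ≤ (S.filter (· ∈ ω)).card} *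
              ((prodBernoulli p).real A - (prodBernoulli p).real ({ω : Set ι | t ≤ (S.filter (· ∈ ω)).card} ∩ A)) *
              (1 - (prodBernoulli p).real {ω : Set ι | t ≤ ((S \ K).filter (· ∈ ω)).card + k})
            + (1 - (prodBernoulli p).real {ω : Set ι | t ≤ (S.filter (· ∈ ω)).card}) *
              (prodBernoulli p).real ({ω : Set ι | s ≤ (S.filter (· ∈ ω)).card} ∩ A) *
              (prodBernoulli p).real {ω : Set ι | s ≤ ((S \ K).filter (· ∈ ω)).card + k}
            - (1 - (prodBernoulli p).real {ω : Set ι | t ≤ (S.filter (· ∈ ω)).card}) *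
              (prodBernoulli p).real {ω : Set ι | s ≤ (S.filter (· ∈ ω)).card} * (prodBernoulli p).real A)) := by
  intro j
  induction j with
  | zero =>
    have h0 : D ∩ {ω : Set ι | (K.filter (· ∈ ω)).card < 0} = ∅ := Set.eq_empty_of_forall_notMem fun ω h => by
      simp only [Set.mem_inter_iff, Set.mem_setOf_eq] at h; omega
    rw [h0, sum_range_zero]; exact twoLumpVar_empty p S t s A
  | succ j ih =>
    have hsplit : D ∩ {ω : Set ι | (K.filter (· ∈ ω)).card < j + 1} =
        (D ∩ {ω : Set ι | (K.filter (· ∈ ω)).card < j}) ∪ (D ∩ {ω : Set ι | (K.filter (· ∈ ω)).card = j}) := by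
      ext ω; simp only [Set.mem_inter_iff, Set.mem_setOf_eq, Set.mem_union]
      constructor
      · rintro ⟨hD, h⟩
        rcases Nat.lt_succ_iff_lt_or_eq.1 h with h | h
        · exact Or.inl ⟨hD, h⟩
        · exact Or.inr ⟨hD, h⟩
      · rintro (⟨hD, h⟩ | ⟨hD, h⟩)
        · exact ⟨hD, by omega⟩
        · exact ⟨hD, by omega⟩
    have hdisj : Disjoint (D ∩ {ω : Set ι | (K.filter (· ∈ ω)).card < j}) (D ∩ {ω : Set ι | (K.filter (· ∈ ω)).card = j}) :=
      Set.disjoint_left.2 fun ω h1 h2 => by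
        simp only [Set.mem_inter_iff, Set.mem_setOf_eq] at h1 h2; omega
    rw [hsplit, twoLumpVar_union p _ _ A _ _ hdisj, ih, sum_range_succ,
      twoLumpVar_level_in p hKS t s j (hDK.inter (determinedBy_layer K j)) (fun ω h => h.2) (Set.inter_subset_left.trans hDA)]

omit [Fintype ι] in
/-- Every point has `K`-level `< #K + 1`. [folklore] -/
theorem inter_ballPart_card_succ (K : Finset ι) (D : Set (Set ι)) :
    D ∩ {ω : Set ι | (K.filter (· ∈ ω)).card < K.card + 1} = D := by
  ext ω
  simp only [Set.mem_inter_iff, Set.mem_setOf_eq, and_iff_left_iff_imp]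
  intro _
  have := Finset.card_le_card (Finset.filter_subset (· ∈ ω) K)
  omega

end SahiOneStep

end Summit.CriticalPhenomena.PercolationContinuityZ3.Theorems
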